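import Literature.NumberTheory.Automorphic.OrbitalIntegralSupportLocalisation          -- ★ p843029∕p843038 (I-5b, ED. 2): generic support localisation, §5 assembly
import Literature.NumberTheory.Rogawski1990.RankOneUnstableTransferNonsplitCMOfCore     -- ★ p843033 A-p19 (G4): `normOne_frame_of_mem_centralizer`, `compactSpace_centralizer_H_of_frame`; brings ★ `finCharpolyTwo_eq_of_isLocalStablyConjH`, `compactSpace_cmDatum_local_one_of_smul_eq`
import Literature.NumberTheory.Rogawski1990.FinExplicitTransferFactorInertPlaceValuation -- ★ B-p10 (g23): `valued_apply_eq_one_of_conjLocal_mul_self`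
import HarnessLib

/-!
# (U5) at `H_v = U(Φ₂)(L⁺_v) × U(Φ₁)(L⁺_v)`: the trace-integral locus is clopen, contains every stable conjugate of every element of an elliptic regular torus, and —
# given the vertex-stabiliser cover of the `U(Φ₂)` factor — localises the support of any `f ∈ C_c^∞(H_v)` for ALL plain orbital integrals along the torus
# (road «R1LL-tree», brick I-5c; Rogawski 1990 Lemma 4.9.3 ∕ Labesse–Langlands §2)

Topic `NumberTheory/Rogawski1990`; namespace `Literature.NumberTheory.Rogawski1990`.  THEOREMS ONLY (no definition, no instance, no notation, no named fact, no `sorry`).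
Cell `pub/hodgecm-mathlib` (D-0151), crux H413 = `stmt-HodgeConjecture-24833`, line «N6nsGerm» stub `stub_N6nsR1LL : RankOneUnstableTransferNonsplitCME` (ED. 4 ★ p842970);
road «R1LL-tree» (LEAD F0P3a-plan (g10) WORD T9-8 (A); architect A-p16 (g27), census v2 e76d2af8, design of record B-p12 (g29) 86286e4d §1 (U5)); brick I-5c = the `H_v`
DRESS of the generic ★ `OrbitalIntegralSupportLocalisation` §5 (interface (I1′) of RULING A-1 (4)), consumed by the inert core assembly (β) (F0P3-p01 (g13),
`RankOneUnstableTransferInertCore`).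

WHAT IS PROVED (at a finite place `v` of `L⁺` with a place `w` of `L` above it fixed by conjugation — non-split):
* §1 `isClopen_setOf_valued_trace_le_one` — `S_w := {g ∈ H_v | v_w(tr g.1) ≤ 1}` is CLOPEN (continuity of `g ↦ (tr g.1)_w`, `𝒪_w` clopen in `L_w`).
* §2 `conj_mem_setOf_valued_trace_le_one_of_mem_centralizer` — for `t₀` regular with an ELLIPTIC eigenframe (`t₀.1·P = P·diag d`, `σ dᵢ·dᵢ = 1`) and every `t ∈ Z(t₀)`, every
  `H_v`-conjugate `h t h⁻¹` lies in `S_w` (`tr t.1 = τ₀ + τ₁` with `τᵢ` of norm one, ★ `normOne_frame_of_mem_centralizer`, ★ `valued_apply_eq_one_of_conjLocal_mul_self`);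
  `mem_setOf_valued_trace_le_one_of_isLocalStablyConjH` — and so does every STABLE conjugate `t′` (★ `finCharpolyTwo_eq_of_isLocalStablyConjH`: same characteristic
  polynomial, hence same trace, Mathlib `Matrix.trace_eq_neg_charpoly_coeff`).
* §3 `exists_sum_integral_conj_eq_of_vertexCover` — THE (I1′) INSTANCE: given two compact open subgroups `K₂ ε ≤ U(Φ₂)_v` (`ε : Fin 2`; the self-dual and the ϖ-modular
  vertex stabilisers) whose conjugates cover the trace-integral locus of `U(Φ₂)_v` (HYPOTHESIS `hcov` = brick I-5a, A-p03 (g25) + F0P2-p02 (g9)'s locus), every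
  `f ∈ C_c^∞(H_v)` decomposes, FOR ALL `t` with `v_w(tr t.1) ≤ 1` and proper orbit map, as `∫ f(h t h⁻¹) dν = Σ_k ∫ φ_k(h t h⁻¹) dν` with finitely many `φ_k ∈ C_c^∞(H_v)`
  supported in `K₂ (ε k) × U(Φ₁)_v` and invariant under its conjugation (the `U(Φ₁)_v` factor is COMPACT at a non-split place, ★ `compactSpace_cmDatum_local_one_of_smul_eq`).
HONEST SCOPE: bookkeeping only; HC_CM is proved only modulo the printed citations (the 2 remaining named inputs hLiu418, h413) until rung 0 closes.

## References
* [Rogawski1990] J. D. Rogawski, *Automorphic Representations of Unitary Groups in Three Variables*, Ann. of Math. Stud. 123 (1990), §4.9 p. 54 (orbital integrals of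
  `C_c^∞` functions), Lemma 4.9.3 p. 56, §3.6 pp. 31–32 (elliptic tori).
* [LabesseLanglands1979] J.-P. Labesse, R. P. Langlands, *L-indistinguishability for SL(2)*, Canad. J. Math. 31 (1979), §2.
* [BernsteinZelevinsky1976] I. N. Bernstein, A. V. Zelevinsky, Russian Math. Surveys 31 (1976), §1.1–§1.3.
-/

set_option autoImplicit false

noncomputable section

open MeasureTheory Measure Topology Set Filter Function NumberField IsDedekindDomain Matrix Polynomial
open scoped MatrixGroups

namespace Literature.NumberTheory.Rogawski1990

open Literature.NumberTheory.Automorphic Literature.NumberTheory.Automorphic.UnitaryGroup Literature.NumberTheory.GaloisRepresentations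

variable (L : Type) [Field L] [NumberField L] [IsCMField L] (v : HeightOneSpectrum (𝓞 ↥(maximalRealSubfield L)))

/-! ## §1 The trace-integral locus of `H_v` is clopen -/

section Locus

variable (w : PlacesOver L v)

/-- `g ↦ (tr g.1)_w` is continuous on `H_v`. [cite: BernsteinZelevinsky1976, §1.1] -/
theorem continuous_valued_trace_fst :
    Continuous fun g : ((cmDatum L 2 (Matrix.of fun i j : Fin 2 => if i.val + j.val + 1 = 2 then (1 : L) else 0)).Local v ×
        (cmDatum L 1 (Matrix.of fun i j : Fin 1 => if i.val + j.val + 1 = 1 then (1 : L) else 0)).Local v) =>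
      ((g.1.val.val : Matrix (Fin 2) (Fin 2) (LocalRing L v)).trace) w := by
  have hM : Continuous fun g : ((cmDatum L 2 (Matrix.of fun i j : Fin 2 => if i.val + j.val + 1 = 2 then (1 : L) else 0)).Local v ×
        (cmDatum L 1 (Matrix.of fun i j : Fin 1 => if i.val + j.val + 1 = 1 then (1 : L) else 0)).Local v) =>
      (g.1.val.val : Matrix (Fin 2) (Fin 2) (LocalRing L v)) :=
    Units.continuous_val.comp (continuous_subtype_val.comp continuous_fst)
  have htr : Continuous fun g : ((cmDatum L 2 (Matrix.of fun i j : Fin 2 => if i.val + j.val + 1 = 2 then (1 : L) else 0)).Local v ×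
        (cmDatum L 1 (Matrix.of fun i j : Fin 1 => if i.val + j.val + 1 = 1 then (1 : L) else 0)).Local v) =>
      (g.1.val.val : Matrix (Fin 2) (Fin 2) (LocalRing L v)).trace := by
    simp only [Matrix.trace, Matrix.diag]
    exact continuous_finsetSum _ fun i _ => (continuous_apply i).comp ((continuous_apply i).comp hM)
  exact (continuous_apply w).comp htr

/-- **The trace-integral locus `S_w := {g ∈ H_v | v_w(tr g.1) ≤ 1}` is CLOPEN** (`𝒪_w` is clopen in `L_w`, Mathlib `Valued.isClopen_integer`).
[cite: BernsteinZelevinsky1976, §1.1] [cite: Rogawski1990, §4.9 p. 54] -/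
theorem isClopen_setOf_valued_trace_le_one :
    IsClopen {g : ((cmDatum L 2 (Matrix.of fun i j : Fin 2 => if i.val + j.val + 1 = 2 then (1 : L) else 0)).Local v ×
        (cmDatum L 1 (Matrix.of fun i j : Fin 1 => if i.val + j.val + 1 = 1 then (1 : L) else 0)).Local v) |
      Valued.v (((g.1.val.val : Matrix (Fin 2) (Fin 2) (LocalRing L v)).trace) w) ≤ 1} := by
  have h : IsClopen {x : w.1.adicCompletion L | Valued.v x ≤ 1} := Valued.isClopen_integer (w.1.adicCompletion L)
  exact h.preimage (continuous_valued_trace_fst L v w)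

end Locus

/-! ## §2 Elliptic regular tori and their stable conjugates lie in the locus -/

section Torus

variable (w : PlacesOver L v) (hw : IsCMField.complexConj L • w.1 = w.1)

/-- Same characteristic polynomial ⇒ same trace (`2 × 2`). [cite: Rogawski1990, §3.1 p. 19] -/
theorem trace_eq_of_finCharpolyTwo_eq
    {a a' : ((cmDatum L 2 (Matrix.of fun i j : Fin 2 => if i.val + j.val + 1 = 2 then (1 : L) else 0)).Local v ×
        (cmDatum L 1 (Matrix.of fun i j : Fin 1 => if i.val + j.val + 1 = 1 then (1 : L) else 0)).Local v)}
    (h : finCharpolyTwo L v a' = finCharpolyTwo L v a) :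
    (a'.1.val.val : Matrix (Fin 2) (Fin 2) (LocalRing L v)).trace = (a.1.val.val : Matrix (Fin 2) (Fin 2) (LocalRing L v)).trace := by
  rw [Matrix.trace_eq_neg_charpoly_coeff, Matrix.trace_eq_neg_charpoly_coeff]
  unfold finCharpolyTwo at h
  rw [h]

include hw in
/-- **Every element of an elliptic regular torus has `w`-integral trace**: for `t₀` with `t₀.1` regular and an eigenframe of norm-one eigenvalues, every `t ∈ Z(t₀)` has
`v_w(tr t.1) ≤ 1` (`tr t.1 = τ₀ + τ₁`, `τᵢ` of norm one ⇒ `v_w(τᵢ) = 1`). [cite: Rogawski1990, §3.6 pp. 31–32] -/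
theorem valued_trace_le_one_of_mem_centralizer
    (t₀ : ((cmDatum L 2 (Matrix.of fun i j : Fin 2 => if i.val + j.val + 1 = 2 then (1 : L) else 0)).Local v ×
        (cmDatum L 1 (Matrix.of fun i j : Fin 1 => if i.val + j.val + 1 = 1 then (1 : L) else 0)).Local v))
    (P : GL (Fin 2) (LocalRing L v)) (d : Fin 2 → LocalRing L v) (ht₀ : IsRegularElt (t₀.1.val : GL (Fin 2) (LocalRing L v)))
    (hP : (t₀.1.val.val : Matrix (Fin 2) (Fin 2) (LocalRing L v)) * P.val = P.val * Matrix.diagonal d)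
    (hd1 : ∀ i, conjLocal L (IsCMField.complexConj L) v (d i) * d i = 1)
    (t : ((cmDatum L 2 (Matrix.of fun i j : Fin 2 => if i.val + j.val + 1 = 2 then (1 : L) else 0)).Local v ×
        (cmDatum L 1 (Matrix.of fun i j : Fin 1 => if i.val + j.val + 1 = 1 then (1 : L) else 0)).Local v))
    (ht : t ∈ Subgroup.centralizer ({t₀} : Set _)) :
    Valued.v (((t.1.val.val : Matrix (Fin 2) (Fin 2) (LocalRing L v)).trace) w) ≤ 1 := by
  obtain ⟨hτ1, hframe⟩ := normOne_frame_of_mem_centralizer L v w hw t₀ P d ht₀ hP hd1 t ht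
  set τ : Fin 2 → LocalRing L v :=
    ![((P⁻¹).val * (t.1.val.val : Matrix (Fin 2) (Fin 2) (LocalRing L v)) * P.val) 0 0,
      ((P⁻¹).val * (t.1.val.val : Matrix (Fin 2) (Fin 2) (LocalRing L v)) * P.val) 1 1] with hτ
  -- `tr t.1 = tr (P diag τ P⁻¹) = τ 0 + τ 1`
  have hPP : P.val * (P⁻¹).val = 1 := by rw [← Units.val_mul, mul_inv_cancel, Units.val_one]
  have ht1 : (t.1.val.val : Matrix (Fin 2) (Fin 2) (LocalRing L v)) = P.val * Matrix.diagonal τ * (P⁻¹).val := by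
    calc (t.1.val.val : Matrix (Fin 2) (Fin 2) (LocalRing L v))
        = (t.1.val.val : Matrix (Fin 2) (Fin 2) (LocalRing L v)) * (P.val * (P⁻¹).val) := by rw [hPP, Matrix.mul_one]
      _ = P.val * Matrix.diagonal τ * (P⁻¹).val := by rw [← Matrix.mul_assoc, hframe]
  have htr : (t.1.val.val : Matrix (Fin 2) (Fin 2) (LocalRing L v)).trace = τ 0 + τ 1 := by
    rw [ht1, Matrix.trace_mul_cycle, ← Units.val_mul, inv_mul_cancel, Units.val_one, Matrix.one_mul, Matrix.trace_diagonal,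
      Fin.sum_univ_two]
  rw [htr, Pi.add_apply]
  have h0 : Valued.v (τ 0 w) = 1 := valued_apply_eq_one_of_conjLocal_mul_self L v w hw (hτ1 0)
  have h1 : Valued.v (τ 1 w) = 1 := valued_apply_eq_one_of_conjLocal_mul_self L v w hw (hτ1 1)
  exact (Valuation.map_add _ _ _).trans (by rw [h0, h1, max_self])

include hw in
/-- **Every `H_v`-conjugate of such a `t` lies in the trace-integral locus** (the trace is a class function). [cite: Rogawski1990, §3.6 pp. 31–32; §4.9 p. 54] -/
theorem conj_mem_setOf_valued_trace_le_one_of_mem_centralizer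
    (t₀ : ((cmDatum L 2 (Matrix.of fun i j : Fin 2 => if i.val + j.val + 1 = 2 then (1 : L) else 0)).Local v ×
        (cmDatum L 1 (Matrix.of fun i j : Fin 1 => if i.val + j.val + 1 = 1 then (1 : L) else 0)).Local v))
    (P : GL (Fin 2) (LocalRing L v)) (d : Fin 2 → LocalRing L v) (ht₀ : IsRegularElt (t₀.1.val : GL (Fin 2) (LocalRing L v)))
    (hP : (t₀.1.val.val : Matrix (Fin 2) (Fin 2) (LocalRing L v)) * P.val = P.val * Matrix.diagonal d)
    (hd1 : ∀ i, conjLocal L (IsCMField.complexConj L) v (d i) * d i = 1)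
    (t : ((cmDatum L 2 (Matrix.of fun i j : Fin 2 => if i.val + j.val + 1 = 2 then (1 : L) else 0)).Local v ×
        (cmDatum L 1 (Matrix.of fun i j : Fin 1 => if i.val + j.val + 1 = 1 then (1 : L) else 0)).Local v))
    (ht : t ∈ Subgroup.centralizer ({t₀} : Set _))
    (h : ((cmDatum L 2 (Matrix.of fun i j : Fin 2 => if i.val + j.val + 1 = 2 then (1 : L) else 0)).Local v ×
        (cmDatum L 1 (Matrix.of fun i j : Fin 1 => if i.val + j.val + 1 = 1 then (1 : L) else 0)).Local v)) :
    h * t * h⁻¹ ∈ {g : ((cmDatum L 2 (Matrix.of fun i j : Fin 2 => if i.val + j.val + 1 = 2 then (1 : L) else 0)).Local v ×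
        (cmDatum L 1 (Matrix.of fun i j : Fin 1 => if i.val + j.val + 1 = 1 then (1 : L) else 0)).Local v) |
      Valued.v (((g.1.val.val : Matrix (Fin 2) (Fin 2) (LocalRing L v)).trace) w) ≤ 1} := by
  have htr : (((h * t * h⁻¹).1.val.val : Matrix (Fin 2) (Fin 2) (LocalRing L v))).trace = (t.1.val.val : Matrix (Fin 2) (Fin 2) (LocalRing L v)).trace := by
    have h0 : ((h * t * h⁻¹).1.val : GL (Fin 2) (LocalRing L v)) =
        (h.1.val : GL (Fin 2) (LocalRing L v)) * (t.1.val : GL (Fin 2) (LocalRing L v)) * (h.1.val : GL (Fin 2) (LocalRing L v))⁻¹ := rfl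
    rw [h0, Units.val_mul, Units.val_mul, Matrix.trace_units_conj]
  simp only [Set.mem_setOf_eq, htr]
  exact valued_trace_le_one_of_mem_centralizer L v w hw t₀ P d ht₀ hP hd1 t ht

include hw in
/-- **Every STABLE conjugate `t′` of such a `t` lies in the locus too** (stable conjugacy preserves the characteristic polynomial, ★ `finCharpolyTwo_eq_of_isLocalStablyConjH`).
[cite: Rogawski1990, §3.1 p. 19; §4.9 p. 55] -/
theorem mem_setOf_valued_trace_le_one_of_isLocalStablyConjH
    (t₀ : ((cmDatum L 2 (Matrix.of fun i j : Fin 2 => if i.val + j.val + 1 = 2 then (1 : L) else 0)).Local v ×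
        (cmDatum L 1 (Matrix.of fun i j : Fin 1 => if i.val + j.val + 1 = 1 then (1 : L) else 0)).Local v))
    (P : GL (Fin 2) (LocalRing L v)) (d : Fin 2 → LocalRing L v) (ht₀ : IsRegularElt (t₀.1.val : GL (Fin 2) (LocalRing L v)))
    (hP : (t₀.1.val.val : Matrix (Fin 2) (Fin 2) (LocalRing L v)) * P.val = P.val * Matrix.diagonal d)
    (hd1 : ∀ i, conjLocal L (IsCMField.complexConj L) v (d i) * d i = 1)
    (t : ((cmDatum L 2 (Matrix.of fun i j : Fin 2 => if i.val + j.val + 1 = 2 then (1 : L) else 0)).Local v ×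
        (cmDatum L 1 (Matrix.of fun i j : Fin 1 => if i.val + j.val + 1 = 1 then (1 : L) else 0)).Local v))
    (ht : t ∈ Subgroup.centralizer ({t₀} : Set _))
    {t' : ((cmDatum L 2 (Matrix.of fun i j : Fin 2 => if i.val + j.val + 1 = 2 then (1 : L) else 0)).Local v ×
        (cmDatum L 1 (Matrix.of fun i j : Fin 1 => if i.val + j.val + 1 = 1 then (1 : L) else 0)).Local v)}
    (hst : IsLocalStablyConjH L v t t')
    (h : ((cmDatum L 2 (Matrix.of fun i j : Fin 2 => if i.val + j.val + 1 = 2 then (1 : L) else 0)).Local v ×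
        (cmDatum L 1 (Matrix.of fun i j : Fin 1 => if i.val + j.val + 1 = 1 then (1 : L) else 0)).Local v)) :
    h * t' * h⁻¹ ∈ {g : ((cmDatum L 2 (Matrix.of fun i j : Fin 2 => if i.val + j.val + 1 = 2 then (1 : L) else 0)).Local v ×
        (cmDatum L 1 (Matrix.of fun i j : Fin 1 => if i.val + j.val + 1 = 1 then (1 : L) else 0)).Local v) |
      Valued.v (((g.1.val.val : Matrix (Fin 2) (Fin 2) (LocalRing L v)).trace) w) ≤ 1} := by
  have htr' : (((h * t' * h⁻¹).1.val.val : Matrix (Fin 2) (Fin 2) (LocalRing L v))).trace = (t'.1.val.val : Matrix (Fin 2) (Fin 2) (LocalRing L v)).trace := by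
    have h0 : ((h * t' * h⁻¹).1.val : GL (Fin 2) (LocalRing L v)) =
        (h.1.val : GL (Fin 2) (LocalRing L v)) * (t'.1.val : GL (Fin 2) (LocalRing L v)) * (h.1.val : GL (Fin 2) (LocalRing L v))⁻¹ := rfl
    rw [h0, Units.val_mul, Units.val_mul, Matrix.trace_units_conj]
  simp only [Set.mem_setOf_eq, htr', trace_eq_of_finCharpolyTwo_eq L v (finCharpolyTwo_eq_of_isLocalStablyConjH L v hst)]
  exact valued_trace_le_one_of_mem_centralizer L v w hw t₀ P d ht₀ hP hd1 t ht

end Torus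

/-! ## §3 The (I1′) instance: support localisation for all plain orbital integrals along the torus, given the vertex cover of `U(Φ₂)_v` -/

section Pieces

variable (w : PlacesOver L v) (hw : IsCMField.complexConj L • w.1 = w.1)
  [MeasurableSpace (((cmDatum L 2 (Matrix.of fun i j : Fin 2 => if i.val + j.val + 1 = 2 then (1 : L) else 0)).Local v ×
    (cmDatum L 1 (Matrix.of fun i j : Fin 1 => if i.val + j.val + 1 = 1 then (1 : L) else 0)).Local v))]
  [BorelSpace (((cmDatum L 2 (Matrix.of fun i j : Fin 2 => if i.val + j.val + 1 = 2 then (1 : L) else 0)).Local v ×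
    (cmDatum L 1 (Matrix.of fun i j : Fin 1 => if i.val + j.val + 1 = 1 then (1 : L) else 0)).Local v))]
  (ν : Measure (((cmDatum L 2 (Matrix.of fun i j : Fin 2 => if i.val + j.val + 1 = 2 then (1 : L) else 0)).Local v ×
    (cmDatum L 1 (Matrix.of fun i j : Fin 1 => if i.val + j.val + 1 = 1 then (1 : L) else 0)).Local v)))
  [ν.IsHaarMeasure] [ν.IsMulRightInvariant]

include hw in
/-- **SUPPORT LOCALISATION ON `H_v` ALONG THE TRACE-INTEGRAL LOCUS.**  Let `K₂ 0, K₂ 1 ≤ U(Φ₂)_v` be compact open subgroups whose `U(Φ₂)_v`-conjugates cover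
`{g₂ | v_w(tr g₂) ≤ 1}` (HYPOTHESIS `hcov`: brick I-5a — every element of `U(Φ₂)_v` of integral trace stabilises a self-dual or a ϖ-modular lattice — with the two loci files).
Then every `f ∈ C_c^∞(H_v)` admits finitely many `φ_k ∈ C_c^∞(H_v)`, `tsupport φ_k ⊆ K₂ (ε k) × U(Φ₁)_v`, each invariant under conjugation by that subgroup, such that
`∫ f(h t h⁻¹) dν = Σ_k ∫ φ_k(h t h⁻¹) dν` for EVERY `t ∈ H_v` with `v_w(tr t.1) ≤ 1` whose orbit map is proper — in particular (by §2 and ★ `isCompact_setOf_conj_mem_of_isClosed`) for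
every regular element of an elliptic torus `Z(t₀)` and every stable conjugate of it.  (★ `exists_sum_integral_conj_eq_of_clopen_cover` at `S = S_w`, `K ε := K₂ ε × U(Φ₁)_v`;
`U(Φ₁)_v` compact at the non-split `v`.) [cite: Rogawski1990, §4.9 p. 54; Lemma 4.9.3 p. 56] [cite: LabesseLanglands1979, §2] [cite: BernsteinZelevinsky1976, §1.3] -/
theorem exists_sum_integral_conj_eq_of_vertexCover
    (K₂ : Fin 2 → Subgroup ((cmDatum L 2 (Matrix.of fun i j : Fin 2 => if i.val + j.val + 1 = 2 then (1 : L) else 0)).Local v))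
    (hK₂o : ∀ ε, IsOpen (K₂ ε : Set ((cmDatum L 2 (Matrix.of fun i j : Fin 2 => if i.val + j.val + 1 = 2 then (1 : L) else 0)).Local v)))
    (hK₂c : ∀ ε, IsCompact (K₂ ε : Set ((cmDatum L 2 (Matrix.of fun i j : Fin 2 => if i.val + j.val + 1 = 2 then (1 : L) else 0)).Local v)))
    (hcov : ∀ g₂ : (cmDatum L 2 (Matrix.of fun i j : Fin 2 => if i.val + j.val + 1 = 2 then (1 : L) else 0)).Local v,
      Valued.v (((g₂.val.val : Matrix (Fin 2) (Fin 2) (LocalRing L v)).trace) w) ≤ 1 →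
        ∃ (ε : Fin 2) (y : (cmDatum L 2 (Matrix.of fun i j : Fin 2 => if i.val + j.val + 1 = 2 then (1 : L) else 0)).Local v), y⁻¹ * g₂ * y ∈ K₂ ε)
    {f : ((cmDatum L 2 (Matrix.of fun i j : Fin 2 => if i.val + j.val + 1 = 2 then (1 : L) else 0)).Local v ×
        (cmDatum L 1 (Matrix.of fun i j : Fin 1 => if i.val + j.val + 1 = 1 then (1 : L) else 0)).Local v) → ℂ}
    (hf : IsLocSmooth f) :
    ∃ (n : ℕ) (ε : Fin n → Fin 2)
      (φ : Fin n → (((cmDatum L 2 (Matrix.of fun i j : Fin 2 => if i.val + j.val + 1 = 2 then (1 : L) else 0)).Local v ×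
        (cmDatum L 1 (Matrix.of fun i j : Fin 1 => if i.val + j.val + 1 = 1 then (1 : L) else 0)).Local v)) → ℂ),
      (∀ k, IsLocSmooth (φ k)) ∧
      (∀ k, tsupport (φ k) ⊆ (((K₂ (ε k)).prod (⊤ : Subgroup ((cmDatum L 1 (Matrix.of fun i j : Fin 1 => if i.val + j.val + 1 = 1 then (1 : L) else 0)).Local v)) :
        Subgroup (((cmDatum L 2 (Matrix.of fun i j : Fin 2 => if i.val + j.val + 1 = 2 then (1 : L) else 0)).Local v ×
          (cmDatum L 1 (Matrix.of fun i j : Fin 1 => if i.val + j.val + 1 = 1 then (1 : L) else 0)).Local v))) : Set _)) ∧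
      (∀ k, ∀ u ∈ (K₂ (ε k)).prod (⊤ : Subgroup ((cmDatum L 1 (Matrix.of fun i j : Fin 1 => if i.val + j.val + 1 = 1 then (1 : L) else 0)).Local v)),
        ∀ x, φ k (u * x * u⁻¹) = φ k x) ∧
      ∀ t : ((cmDatum L 2 (Matrix.of fun i j : Fin 2 => if i.val + j.val + 1 = 2 then (1 : L) else 0)).Local v ×
          (cmDatum L 1 (Matrix.of fun i j : Fin 1 => if i.val + j.val + 1 = 1 then (1 : L) else 0)).Local v),
        Valued.v (((t.1.val.val : Matrix (Fin 2) (Fin 2) (LocalRing L v)).trace) w) ≤ 1 →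
        (∀ Q : Set _, IsCompact Q → IsCompact {h : ((cmDatum L 2 (Matrix.of fun i j : Fin 2 => if i.val + j.val + 1 = 2 then (1 : L) else 0)).Local v ×
          (cmDatum L 1 (Matrix.of fun i j : Fin 1 => if i.val + j.val + 1 = 1 then (1 : L) else 0)).Local v) | h * t * h⁻¹ ∈ Q}) →
        ∫ h, f (h * t * h⁻¹) ∂ν = ∑ k, ∫ h, φ k (h * t * h⁻¹) ∂ν := by
  haveI : CompactSpace ((cmDatum L 1 (Matrix.of fun i j : Fin 1 => if i.val + j.val + 1 = 1 then (1 : L) else 0)).Local v) :=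
    compactSpace_cmDatum_local_one_of_smul_eq L v w hw
  -- the product subgroups `K ε := K₂ ε × U(Φ₁)_v` are compact open
  let K : Fin 2 → Subgroup (((cmDatum L 2 (Matrix.of fun i j : Fin 2 => if i.val + j.val + 1 = 2 then (1 : L) else 0)).Local v ×
      (cmDatum L 1 (Matrix.of fun i j : Fin 1 => if i.val + j.val + 1 = 1 then (1 : L) else 0)).Local v)) := fun ε => (K₂ ε).prod ⊤
  have hKcoe : ∀ ε, (K ε : Set (((cmDatum L 2 (Matrix.of fun i j : Fin 2 => if i.val + j.val + 1 = 2 then (1 : L) else 0)).Local v ×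
      (cmDatum L 1 (Matrix.of fun i j : Fin 1 => if i.val + j.val + 1 = 1 then (1 : L) else 0)).Local v))) =
      (K₂ ε : Set ((cmDatum L 2 (Matrix.of fun i j : Fin 2 => if i.val + j.val + 1 = 2 then (1 : L) else 0)).Local v)) ×ˢ
        (Set.univ : Set ((cmDatum L 1 (Matrix.of fun i j : Fin 1 => if i.val + j.val + 1 = 1 then (1 : L) else 0)).Local v)) := by
    intro ε; ext g; simp [K, Subgroup.mem_prod]
  have hKo : ∀ ε, IsOpen ((K ε : Subgroup (((cmDatum L 2 (Matrix.of fun i j : Fin 2 => if i.val + j.val + 1 = 2 then (1 : L) else 0)).Local v ×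
      (cmDatum L 1 (Matrix.of fun i j : Fin 1 => if i.val + j.val + 1 = 1 then (1 : L) else 0)).Local v))) : Set (((cmDatum L 2 (Matrix.of fun i j : Fin 2 => if i.val + j.val + 1 = 2 then (1 : L) else 0)).Local v ×
      (cmDatum L 1 (Matrix.of fun i j : Fin 1 => if i.val + j.val + 1 = 1 then (1 : L) else 0)).Local v))) := fun ε => by rw [hKcoe]; exact (hK₂o ε).prod isOpen_univ
  have hKc : ∀ ε, IsCompact ((K ε : Subgroup (((cmDatum L 2 (Matrix.of fun i j : Fin 2 => if i.val + j.val + 1 = 2 then (1 : L) else 0)).Local v ×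
      (cmDatum L 1 (Matrix.of fun i j : Fin 1 => if i.val + j.val + 1 = 1 then (1 : L) else 0)).Local v))) : Set (((cmDatum L 2 (Matrix.of fun i j : Fin 2 => if i.val + j.val + 1 = 2 then (1 : L) else 0)).Local v ×
      (cmDatum L 1 (Matrix.of fun i j : Fin 1 => if i.val + j.val + 1 = 1 then (1 : L) else 0)).Local v))) := fun ε => by rw [hKcoe]; exact (hK₂c ε).prod isCompact_univ
  -- the locus is clopen and covered by the conjugates of the `K ε`
  have hS := isClopen_setOf_valued_trace_le_one L v w
  have hcov' : {g : ((cmDatum L 2 (Matrix.of fun i j : Fin 2 => if i.val + j.val + 1 = 2 then (1 : L) else 0)).Local v ×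
        (cmDatum L 1 (Matrix.of fun i j : Fin 1 => if i.val + j.val + 1 = 1 then (1 : L) else 0)).Local v) |
      Valued.v (((g.1.val.val : Matrix (Fin 2) (Fin 2) (LocalRing L v)).trace) w) ≤ 1} ⊆
      ⋃ ε, ⋃ y, (fun x => y * x * y⁻¹) '' ((K ε : Subgroup (((cmDatum L 2 (Matrix.of fun i j : Fin 2 => if i.val + j.val + 1 = 2 then (1 : L) else 0)).Local v ×
      (cmDatum L 1 (Matrix.of fun i j : Fin 1 => if i.val + j.val + 1 = 1 then (1 : L) else 0)).Local v))) : Set (((cmDatum L 2 (Matrix.of fun i j : Fin 2 => if i.val + j.val + 1 = 2 then (1 : L) else 0)).Local v ×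
      (cmDatum L 1 (Matrix.of fun i j : Fin 1 => if i.val + j.val + 1 = 1 then (1 : L) else 0)).Local v))) := by
    intro g hg
    obtain ⟨ε, y, hy⟩ := hcov g.1 hg
    refine Set.mem_iUnion.2 ⟨ε, Set.mem_iUnion.2 ⟨((y, 1) : _ × _), ?_⟩⟩
    refine ⟨(y, (1 : _))⁻¹ * g * (y, 1), ?_, by group⟩
    simp only [SetLike.mem_coe, K, Subgroup.mem_prod, Prod.inv_mk, inv_one, Subgroup.mem_top, and_true]
    exact hy
  obtain ⟨n, i, φ, hφ, hφK, hφinv, hint⟩ := exists_sum_integral_conj_eq_of_clopen_cover ν K hKo hKc hS hcov' hf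
  exact ⟨n, i, φ, hφ, hφK, hφinv, fun t ht hprop => hint t (fun h => by
    have htr : (((h * t * h⁻¹).1.val.val : Matrix (Fin 2) (Fin 2) (LocalRing L v))).trace = (t.1.val.val : Matrix (Fin 2) (Fin 2) (LocalRing L v)).trace := by
      have h0 : ((h * t * h⁻¹).1.val : GL (Fin 2) (LocalRing L v)) =
          (h.1.val : GL (Fin 2) (LocalRing L v)) * (t.1.val : GL (Fin 2) (LocalRing L v)) * (h.1.val : GL (Fin 2) (LocalRing L v))⁻¹ := rfl
      rw [h0, Units.val_mul, Units.val_mul, Matrix.trace_units_conj]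
    simp only [Set.mem_setOf_eq, htr]; exact ht) hprop⟩

end Pieces

end Literature.NumberTheory.Rogawski1990

end
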